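import Summits.BirchSwinnertonDyer.BirchSwinnertonDyer.Theorems.Rank1ResidualJetRowDualityEll
import Literature.NumberTheory.EllipticCurves.PoitouTateSelmerStructuresConj
import HarnessLib

/-!
# T1 JET (cell `bsd-jet`), road K: the DUALITY INPUTS `hC`, `hdual_q`, `hdual_ℓ` of the row theorem
# `JET.tamagawaExponent_le_mInfty_of_rowData` (pv-2, p492296), packaged — `∃ C'` with all three

HONEST FRAMING (programme file `BSD-LIT2PART-PROGRAMME-v1.md` §HONESTY, verbatim): «no tranche here
proves BSD; ARM L moves the LITERAL column of an r ≤ 1 census into the kernel-proved-modulo-named-print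
column; ARM P changes what «named print» is worth.» THEOREMS ONLY (seat `bsd-jet-pv-1`, session g5;
`--supports stmt-BirchSwinnertonDyer-14418`, helper): no definition, no named fact, no `sorry`.
Nothing is booked; 0 classes move.

## What

`exists_rowDuality` (structure currency) and `exists_rowDuality_modified` (the row theorem's literal
currency, `modifiedSelmerGroup` for `H_{𝓕(c)}` under the reconciliation hypothesis `hT` of the row
theorem): from
* the NAMED FACT `poitouTate_selmerStructure_duality_conj K` (Poitou–Tate for Selmer structures with a
  conjugation-compatible family of invariant maps; `Literature/…/PoitouTateSelmerStructuresConj`),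
* a Weil pairing datum `e` on `E[p^k]` over `K` (bilinear, alternating, non-degenerate,
  `Γ_K`-equivariant — the tree's PROVED `exists_weilPairing_holds` supplies these) which is moreover
  equivariant under the lift `liftAut τ` of complex conjugation (`hτe`; true for THE Weil pairing of a
  curve over `ℚ`, Silverman III.8.1 (d) over `ℚ`; to be discharged separately),
* `τ² = 1`, `p` odd, `k ≥ 1`, `c ≠ 0`,
* the transverse family `𝒯`: `σ`-stable and SELF-DUAL (for every perfect family) at the primes
  dividing `c` — properties of Jetchev's `H¹_tr` (§3.1.2), inputs here,
* the stringent family `𝒮 ≤ Kum`: `σ`-stable at the carrier pair `{v₀, τv₀}` (`v₀ ≠ τv₀` above the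
  conductor), with `Kum_{v₀}/𝒮_{v₀}` cyclic of order `p^t` (Jetchev (δ), Lemma 3.2 / Cor. of §3.1),
* the local term at the Kolyvagin primes `ℓ ∤ c`: `(Kum_λ).relIndex (ker(σ_{*,λ} − s)) = p^k`
  (Lemma 5.2 (i)–(ii)),
there is a subgroup `C' ⊆ H¹(K, E[p^k])^s` (namely `(w⁻¹ H¹_{𝓕_⌈q⌉(c)^*})^s`, `w` the Weil transport)
satisfying VERBATIM the hypotheses `hC`, `hdual_q`, `hdual_ℓ` of `JET.tamagawaExponent_le_mInfty_of_rowData`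
(with `s = −e`, `Qcar = {v₀, τ • v₀}`). So the row theorem's two duality packages are reduced to the
four local ∕ structural inputs above plus one named fact.

References (locators only; no cited FACT is declared here): [cite: Jetchev2008, Thm. 5.1, Lemma 5.2,
proof of Thm. 5.2 (pp. 821–823) = arXiv Thm. 6.3] [cite: Howard2004HeegnerKolyvagin, Thm. 2.1.11]
[cite: MilneADT2006, Ch. I, Thm. 4.10, Cor. 2.3] [cite: SilvermanAEC2009, Prop. III.8.1].
Design: no definitions; `K : Type`. Axioms: `propext`, `Classical.choice`, `Quot.sound`.
-/

set_option autoImplicit false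

noncomputable section

open scoped Classical Pointwise
open Function NumberField IsDedekindDomain WeierstrassCurve Field
open Literature.NumberTheory.EllipticCurves Literature.NumberTheory.GaloisRepresentations
open Literature.NumberTheory.EllipticCurves.Jetchev2008
open Literature.NumberTheory.GaloisCohomology Literature.NumberTheory.Automorphic
open Literature.NumberTheory.GaloisRepresentations.DiscreteGaloisModule (localTatePairingZMod
  tateDual SelmerStructure)
open Summit.BirchSwinnertonDyer.Rank1Residual.JET.SelmerVocabulary

namespace Summit.BirchSwinnertonDyer.Rank1Residual.JET.GlobalDuality

section Row

variable {K : Type} [Field K] [NumberField K] (W : WeierstrassCurve ℚ) [W.IsElliptic]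
  [W.IsGloballyMinimal]
  (τ : K ≃ₐ[ℚ] K) (p k : ℕ) [Fact p.Prime] [NeZero (p ^ k)]
  [Finite (geomTorsion (W.baseChange K) ((p ^ k : ℕ) : ℤ))]
  (e : geomTorsion (W.baseChange K) ((p ^ k : ℕ) : ℤ) → geomTorsion (W.baseChange K) ((p ^ k : ℕ) : ℤ) →
    AlgebraicClosure K)
  (hμ : ∀ S T, e S T ^ (p ^ k) = 1)
  (hadd₁ : ∀ S₁ S₂ T, e (S₁ + S₂) T = e S₁ T * e S₂ T)
  (hadd₂ : ∀ S T₁ T₂, e S (T₁ + T₂) = e S T₁ * e S T₂)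
  (hgal : ∀ (g : absoluteGaloisGroup K) (S T : geomTorsion (W.baseChange K) ((p ^ k : ℕ) : ℤ)),
    g • e S T = e (g • S) (g • T))
  (halt : ∀ T, e T T = 1) (hnondeg : ∀ T, (∀ S, e S T = 1) → T = 0)
  (hτe : ∀ S T, liftAut τ (e S T) =
    e ((isLiftOfAut_liftAut τ).torsionMap W ((p ^ k : ℕ) : ℤ) S)
      ((isLiftOfAut_liftAut τ).torsionMap W ((p ^ k : ℕ) : ℤ) T))

include halt hnondeg hτe in
/-- **The duality inputs of the row theorem, packaged (structure currency).** Under the named fact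
`poitouTate_selmerStructure_duality_conj K` and the inputs listed in the module docstring there is
`C' ⊆ H¹(K, E[p^k])^s` with: (`hC`) `C' ≤ (⊤)^s`; (`hdual_q`) Jetchev Thm. 5.1 + (δ) at the carrier pair
for `𝓕_⌈q⌉(c) ≼ 𝓕(c)`; (`hdual_ℓ`) Lemma 5.2 (iii) at every Kolyvagin prime `ℓ ∤ c` — in the shapes
consumed by `JET.tamagawaExponent_le_mInfty_of_rowData` with `H_{𝓕(c)} = (selmerF …).selmerGroup`.
[cite: Jetchev2008, Thm. 5.1, Lemma 5.2, proof of Thm. 5.2 (pp. 821–823)]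
[cite: Howard2004HeegnerKolyvagin, Thm. 2.1.11] [cite: MilneADT2006, Ch. I, Thm. 4.10(b)] -/
theorem exists_rowDuality (hPT : poitouTate_selmerStructure_duality_conj K)
    (hτ : τ * τ = 1) (hp2 : p ≠ 2) (hk : 1 ≤ k)
    (𝒯 𝒮 : SelmerStructure ((W.baseChange K).torsionGaloisModule ((p ^ k : ℕ) : ℤ)))
    {c : ℕ} (hc : c ≠ 0)
    (h𝒯σ : ∀ (v w : HeightOneSpectrum (𝓞 K)) (h : τ • v = w), v ∈ placesDividing K c →
      ∀ x : galoisCohomology (((W.baseChange K).torsionGaloisModule ((p ^ k : ℕ) : ℤ)).toLocal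
        (Sum.inr v : Place K)) 1,
      x ∈ 𝒯 (Sum.inr v) → conjActPlace W τ ((p ^ k : ℕ) : ℤ) h x ∈ 𝒯 (Sum.inr w))
    (h𝒯sd : ∀ inv : LocalInvariants K (p ^ k), inv.IsPerfect → ∀ v ∈ placesDividing K c,
      inv.dualTransported 𝒯 (weilDualIntertwining (W.baseChange K) (p ^ k) e hμ hadd₁ hadd₂ hgal)
        (Sum.inr v) = 𝒯 (Sum.inr v))
    (hS : ∀ v, 𝒮 v ≤ (W.baseChange K).kummerSelmerStructure ((p ^ k : ℕ) : ℤ) v)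
    (v₀ : HeightOneSpectrum (𝓞 K)) (hv₀ : τ • v₀ ≠ v₀)
    (hQc : Disjoint ({v₀, τ • v₀} : Finset (HeightOneSpectrum (𝓞 K))) (placesDividing K c))
    (h𝒮σ : ∀ (v w : HeightOneSpectrum (𝓞 K)) (h : τ • v = w), v ∈ ({v₀, τ • v₀} : Finset _) →
      ∀ x : galoisCohomology (((W.baseChange K).torsionGaloisModule ((p ^ k : ℕ) : ℤ)).toLocal
        (Sum.inr v : Place K)) 1,
      x ∈ 𝒮 (Sum.inr v) → conjActPlace W τ ((p ^ k : ℕ) : ℤ) h x ∈ 𝒮 (Sum.inr w))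
    {t : ℕ}
    (hcyc : IsAddCyclic (↥((W.baseChange K).kummerSelmerStructure ((p ^ k : ℕ) : ℤ) (Sum.inr v₀)) ⧸
      (𝒮 (Sum.inr v₀)).addSubgroupOf ((W.baseChange K).kummerSelmerStructure ((p ^ k : ℕ) : ℤ) (Sum.inr v₀))))
    (hidx : (𝒮 (Sum.inr v₀)).relIndex
      ((W.baseChange K).kummerSelmerStructure ((p ^ k : ℕ) : ℤ) (Sum.inr v₀)) = p ^ t)
    (Ncond : ℕ) (hQN : (Ncond : 𝓞 K) ∈ v₀.asIdeal)
    {s : ℤ} (hs : s = 1 ∨ s = -1)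
    (hloc : ∀ ℓ : ℕ, Zhang2014.IsKolyvaginPrime Ncond W K p ℓ → k ≤ Zhang2014.kolyvaginIndex W p ℓ →
      ℓ ∉ c.primeFactors → ∀ (v : HeightOneSpectrum (𝓞 K)), (ℓ : 𝓞 K) ∈ v.asIdeal → ∀ (hfix : τ • v = v),
      ((W.baseChange K).kummerSelmerStructure ((p ^ k : ℕ) : ℤ) (Sum.inr v)).relIndex
        ((conjActPlace W τ ((p ^ k : ℕ) : ℤ) hfix - s • AddMonoidHom.id _).ker) = p ^ k) :
    ∃ C' : AddSubgroup (galoisCohomology ((W.baseChange K).torsionGaloisModule ((p ^ k : ℕ) : ℤ)) 1),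
      C' ≤ signPart W K τ ((p ^ k : ℕ) : ℤ) s ⊤ ∧
      (∃ (Qg Qg' : Type) (_ : AddCommGroup Qg) (_ : AddCommGroup Qg') (_ : Finite Qg')
        (locq : signPart W K τ ((p ^ k : ℕ) : ℤ) s
          (selmerF W ((p ^ k : ℕ) : ℤ) 𝒯 (placesDividing K c)).selmerGroup →+ Qg)
        (locq' : C' →+ Qg'),
        (∀ x : C', locq' x = 0 ↔
          (x : galoisCohomology ((W.baseChange K).torsionGaloisModule ((p ^ k : ℕ) : ℤ)) 1) ∈
            signPart W K τ ((p ^ k : ℕ) : ℤ) s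
              (selmerF W ((p ^ k : ℕ) : ℤ) 𝒯 (placesDividing K c)).selmerGroup) ∧
        Nat.card locq.range * Nat.card locq'.range = Nat.card Qg' ∧ IsAddCyclic Qg' ∧
        Nat.card Qg' = p ^ t) ∧
      (∀ ℓ : ℕ, Zhang2014.IsKolyvaginPrime Ncond W K p ℓ → k ≤ Zhang2014.kolyvaginIndex W p ℓ →
        ℓ ∉ c.primeFactors → ∀ (v : HeightOneSpectrum (𝓞 K)), (ℓ : 𝓞 K) ∈ v.asIdeal →
        ∃ (Sg : Type) (_ : AddCommGroup Sg)
          (sing : signPart W K τ ((p ^ k : ℕ) : ℤ) s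
            (((selmerF0 W ((p ^ k : ℕ) : ℤ) 𝒯 𝒮 (placesDividing K c) {v₀, τ • v₀}).relaxedAt {v}).selmerGroup)
              →+ Sg),
          (∀ x, sing x = 0 ↔
            (x : galoisCohomology ((W.baseChange K).torsionGaloisModule ((p ^ k : ℕ) : ℤ)) 1) ∈
              signPart W K τ ((p ^ k : ℕ) : ℤ) s
                (selmerF0 W ((p ^ k : ℕ) : ℤ) 𝒯 𝒮 (placesDividing K c) {v₀, τ • v₀}).selmerGroup) ∧
          Nat.card sing.range *
            Nat.card (C'.map (galoisCohomology.localization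
              ((W.baseChange K).torsionGaloisModule ((p ^ k : ℕ) : ℤ)) (Sum.inr v : Place K) 1)) = p ^ k) := by
  obtain ⟨inv, hperf, hvan, -, hSC, hconj⟩ := hPT (p ^ k)
  exact ⟨_, signPart_mono W K τ _ s le_top,
    exists_locq_of_pair W τ p k e hμ hadd₁ hadd₂ hgal halt hnondeg hτe hτ hp2 hk inv hperf hvan hSC (hconj τ)
      𝒯 𝒮 hc h𝒯σ (h𝒯sd inv hperf) hS v₀ hv₀ hQc h𝒮σ hcyc hidx hs,
    exists_sing_of_kolyvaginPrime W τ p k e hμ hadd₁ hadd₂ hgal hnondeg hτe hτ hp2 inv hperf hvan hSC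
      (hconj τ) 𝒯 𝒮 hc h𝒯σ v₀ h𝒮σ Ncond hQN hs hloc⟩

include halt hnondeg hτe in
/-- **The duality inputs of the row theorem, packaged in its LITERAL currency**: as
`exists_rowDuality`, with `H_{𝓕(c)}` written as lit-ty's `modifiedSelmerGroup W K ι (p^k) c` under the
reconciliation hypothesis `hT` of `JET.tamagawaExponent_le_mInfty_of_rowData` (the transverse family
cuts out `transverseKer` at the primes dividing `c`; `selmerGroup_selmerF_eq_modifiedSelmerGroup`).
Feeding `obtain ⟨C', hC, hdual_q, hdual_ℓ⟩ := exists_rowDuality_modified …` into the row theorem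
(with `e := −s`, `Qcar := {v₀, τ • v₀}`) discharges its hypotheses `hC`, `hdual_q`, `hdual_ℓ`.
[cite: Jetchev2008, Thm. 5.1, Lemma 5.2, proof of Thm. 5.2 (pp. 821–823)]
[cite: Howard2004HeegnerKolyvagin, Thm. 2.1.11] [cite: MilneADT2006, Ch. I, Thm. 4.10(b)] -/
theorem exists_rowDuality_modified (hPT : poitouTate_selmerStructure_duality_conj K)
    (ι : K →+* ℂ) [∀ j : ℕ, NumberField (ringClassField K ι j)]
    (hτ : τ * τ = 1) (hp2 : p ≠ 2) (hk : 1 ≤ k)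
    (𝒯 𝒮 : SelmerStructure ((W.baseChange K).torsionGaloisModule ((p ^ k : ℕ) : ℤ)))
    {c : ℕ} (hc : c ≠ 0)
    (hT : ∀ x : galoisCohomology ((W.baseChange K).torsionGaloisModule ((p ^ k : ℕ) : ℤ)) 1,
      (∀ w ∈ placesDividing K c,
        galoisCohomology.localization ((W.baseChange K).torsionGaloisModule ((p ^ k : ℕ) : ℤ))
          (Sum.inr w) 1 x ∈ 𝒯 (Sum.inr w)) ↔
      ∀ ℓ ∈ c.primeFactors, x ∈ transverseKer W K ι ((p ^ k : ℕ) : ℤ) ℓ)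
    (h𝒯σ : ∀ (v w : HeightOneSpectrum (𝓞 K)) (h : τ • v = w), v ∈ placesDividing K c →
      ∀ x : galoisCohomology (((W.baseChange K).torsionGaloisModule ((p ^ k : ℕ) : ℤ)).toLocal
        (Sum.inr v : Place K)) 1,
      x ∈ 𝒯 (Sum.inr v) → conjActPlace W τ ((p ^ k : ℕ) : ℤ) h x ∈ 𝒯 (Sum.inr w))
    (h𝒯sd : ∀ inv : LocalInvariants K (p ^ k), inv.IsPerfect → ∀ v ∈ placesDividing K c,
      inv.dualTransported 𝒯 (weilDualIntertwining (W.baseChange K) (p ^ k) e hμ hadd₁ hadd₂ hgal)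
        (Sum.inr v) = 𝒯 (Sum.inr v))
    (hS : ∀ v, 𝒮 v ≤ (W.baseChange K).kummerSelmerStructure ((p ^ k : ℕ) : ℤ) v)
    (v₀ : HeightOneSpectrum (𝓞 K)) (hv₀ : τ • v₀ ≠ v₀)
    (hQc : Disjoint ({v₀, τ • v₀} : Finset (HeightOneSpectrum (𝓞 K))) (placesDividing K c))
    (h𝒮σ : ∀ (v w : HeightOneSpectrum (𝓞 K)) (h : τ • v = w), v ∈ ({v₀, τ • v₀} : Finset _) →
      ∀ x : galoisCohomology (((W.baseChange K).torsionGaloisModule ((p ^ k : ℕ) : ℤ)).toLocal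
        (Sum.inr v : Place K)) 1,
      x ∈ 𝒮 (Sum.inr v) → conjActPlace W τ ((p ^ k : ℕ) : ℤ) h x ∈ 𝒮 (Sum.inr w))
    {t : ℕ}
    (hcyc : IsAddCyclic (↥((W.baseChange K).kummerSelmerStructure ((p ^ k : ℕ) : ℤ) (Sum.inr v₀)) ⧸
      (𝒮 (Sum.inr v₀)).addSubgroupOf ((W.baseChange K).kummerSelmerStructure ((p ^ k : ℕ) : ℤ) (Sum.inr v₀))))
    (hidx : (𝒮 (Sum.inr v₀)).relIndex
      ((W.baseChange K).kummerSelmerStructure ((p ^ k : ℕ) : ℤ) (Sum.inr v₀)) = p ^ t)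
    (Ncond : ℕ) (hQN : (Ncond : 𝓞 K) ∈ v₀.asIdeal)
    {s : ℤ} (hs : s = 1 ∨ s = -1)
    (hloc : ∀ ℓ : ℕ, Zhang2014.IsKolyvaginPrime Ncond W K p ℓ → k ≤ Zhang2014.kolyvaginIndex W p ℓ →
      ℓ ∉ c.primeFactors → ∀ (v : HeightOneSpectrum (𝓞 K)), (ℓ : 𝓞 K) ∈ v.asIdeal → ∀ (hfix : τ • v = v),
      ((W.baseChange K).kummerSelmerStructure ((p ^ k : ℕ) : ℤ) (Sum.inr v)).relIndex
        ((conjActPlace W τ ((p ^ k : ℕ) : ℤ) hfix - s • AddMonoidHom.id _).ker) = p ^ k) :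
    ∃ C' : AddSubgroup (galoisCohomology ((W.baseChange K).torsionGaloisModule ((p ^ k : ℕ) : ℤ)) 1),
      C' ≤ signPart W K τ ((p ^ k : ℕ) : ℤ) s ⊤ ∧
      (∃ (Qg Qg' : Type) (_ : AddCommGroup Qg) (_ : AddCommGroup Qg') (_ : Finite Qg')
        (locq : signPart W K τ ((p ^ k : ℕ) : ℤ) s (modifiedSelmerGroup W K ι ((p ^ k : ℕ) : ℤ) c) →+ Qg)
        (locq' : C' →+ Qg'),
        (∀ x : C', locq' x = 0 ↔
          (x : galoisCohomology ((W.baseChange K).torsionGaloisModule ((p ^ k : ℕ) : ℤ)) 1) ∈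
            signPart W K τ ((p ^ k : ℕ) : ℤ) s (modifiedSelmerGroup W K ι ((p ^ k : ℕ) : ℤ) c)) ∧
        Nat.card locq.range * Nat.card locq'.range = Nat.card Qg' ∧ IsAddCyclic Qg' ∧
        Nat.card Qg' = p ^ t) ∧
      (∀ ℓ : ℕ, Zhang2014.IsKolyvaginPrime Ncond W K p ℓ → k ≤ Zhang2014.kolyvaginIndex W p ℓ →
        ℓ ∉ c.primeFactors → ∀ (v : HeightOneSpectrum (𝓞 K)), (ℓ : 𝓞 K) ∈ v.asIdeal →
        ∃ (Sg : Type) (_ : AddCommGroup Sg)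
          (sing : signPart W K τ ((p ^ k : ℕ) : ℤ) s
            (((selmerF0 W ((p ^ k : ℕ) : ℤ) 𝒯 𝒮 (placesDividing K c) {v₀, τ • v₀}).relaxedAt {v}).selmerGroup)
              →+ Sg),
          (∀ x, sing x = 0 ↔
            (x : galoisCohomology ((W.baseChange K).torsionGaloisModule ((p ^ k : ℕ) : ℤ)) 1) ∈
              signPart W K τ ((p ^ k : ℕ) : ℤ) s
                (selmerF0 W ((p ^ k : ℕ) : ℤ) 𝒯 𝒮 (placesDividing K c) {v₀, τ • v₀}).selmerGroup) ∧
          Nat.card sing.range *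
            Nat.card (C'.map (galoisCohomology.localization
              ((W.baseChange K).torsionGaloisModule ((p ^ k : ℕ) : ℤ)) (Sum.inr v : Place K) 1)) = p ^ k) := by
  rw [← selmerGroup_selmerF_eq_modifiedSelmerGroup W ι ((p ^ k : ℕ) : ℤ) 𝒯 hc hT]
  exact exists_rowDuality W τ p k e hμ hadd₁ hadd₂ hgal halt hnondeg hτe hPT hτ hp2 hk 𝒯 𝒮 hc h𝒯σ h𝒯sd hS v₀
    hv₀ hQc h𝒮σ hcyc hidx Ncond hQN hs hloc

end Row

end Summit.BirchSwinnertonDyer.Rank1Residual.JET.GlobalDuality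

end
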